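import Summits.AtomisticToContinuum.HydrodynamicLimit.Theorems.JParityClosureOddContactSymmetryGibbsInvariance
import Summits.AtomisticToContinuum.HydrodynamicLimit.Theorems.BoltzmannGreenKubo.Negative.TimeAverage
import Summits.AtomisticToContinuum.HydrodynamicLimit.Theorems.AntiMazurCoboundariesTransferSkeleton
import Summits.AtomisticToContinuum.HydrodynamicLimit.Theorems.AntiMazurCoboundariesInfluenceLocalityObjects
import Summits.AtomisticToContinuum.HydrodynamicLimit.Theorems.AntiMazurCoboundariesCorrectorPressureDecayShotNoisePacking
import Summits.AtomisticToContinuum.HydrodynamicLimit.Theorems.AntiMazurCoboundariesCorrectorPressureDecayShotNoiseOneSite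
import Summits.AtomisticToContinuum.HydrodynamicLimit.Theorems.AntiMazurCoboundariesCorrectorPressureDecayShotNoisePairsBound
import Summits.AtomisticToContinuum.HydrodynamicLimit.Theorems.AntiMazurCoboundariesCorrectorPressureDecayShotNoiseStatic
import Summits.AtomisticToContinuum.HydrodynamicLimit.Theorems.AntiMazurCoboundariesCorrectorPressureDecayShotNoiseTubeCount
import Summits.AtomisticToContinuum.HydrodynamicLimit.Theorems.AntiMazurCoboundariesCorrectorPressureDecayShotNoiseKinematics
import Summits.AtomisticToContinuum.HydrodynamicLimit.Theorems.AntiMazurCoboundariesCorrectorPressureDecayShotNoisePathwise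

/-!
# Within-lag shot-noise pressure (layer-2 input h₂ of the local-certificate transfer) — assembly

Route `AntiMazurCoboundaries` of `AtomisticToContinuum/HydrodynamicLimit`, crux stmt-AtomisticToContinuum-14135
(`CorrectorPressureDecay`, "X"), line `almost-invariant-duality`, lead seat c5. The landed layer-2 transfer
`TransferSkeleton.correctorPressureDecay_of_inputs h₁ h₂ h₃ : X` (p89394) has three typed inputs; this file PROVES the second,
`shotNoisePressure` (registered; its type is VERBATIM the hypothesis `h₂`, see the closing `example`): for every bounded one-body
observable `F = Σᵢ φ(xᵢ) g((vᵢ − u₀)/√θ)`, amplitude `A` and tolerance `ψ`, SOME kinetic lag `s ≤ s₁` makes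
`∫ exp(A(F − (sℓ)⁻¹∫₀^{sℓ} F∘Φ_u du)) dG_N ≤ e^{ψ(N+1)}` for all large `N`, uniformly in the hard-sphere flow `Φ`
(`ℓ = (N+1)^{-1/3}`, `G_N` the homogeneous Gibbs law, reduced diameter `σ < σ₀ = 1/4`).

Proof (no cluster expansion). PATHWISE (`sum_sub_sum_flow_le`, `snp_kinematics` = `snp_kinematics_of_tubeCount` ∘
`snp_tubeCount` ∘ `snp_packing`): along a good orbit, with path lengths `dᵢ = ∫₀ᴸ‖vᵢ‖`, `L = sℓ`, and tameness radius
`r = RL ≤ ε`, a sphere whose velocity changed collided (flight-start alternative), so it is a WANDERER (`dᵢ > r`), or in a STATIC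
CLOSE PAIR (`dist ≤ ε + 2r` at time `0`), or within `2ε` of a wanderer's path (≤ `1331(d/ε + 1)` such spheres per wanderer, by
ε-separation); hence `F(z) − F(Φ_u z) ≤ (N+1)K₁η + 2K₁(S(z) + Σⱼ[dⱼ > r](2 + 1331(dⱼ/ε + 1)))` uniformly in `u ∈ [0, L]`
(`η` the continuity budget of `φ` at scale `ρ > r`). WANDERERS (`wander_le_windowAvg`): the sum is dominated by the window
average of the one-body functional `qf(v) = (4AK₁·2664/R)·max 0 (2‖v‖ − R)`, whose exponential moment is STATIC
(Jensen in time + invariance + Gaussian factorisation, `lintegral_exp_windowAvg_sum_localGibbsLaw_const_le`) with one-site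
value `≤ e^{ψ/2}` for `R ≥ R₀` (`snp_oneSite`). STATIC PAIRS (`snp_static` = `snp_static_of_pairsBound` ∘ `snp_pairsBound` ∘
`snp_packing`): pressure `≤ (ψ/2)(N+1)` once `lam = 2Rs/σ ≤ lam₀` and `N ≥ N₁`. ASSEMBLY: `η = ψ/(2AK₁)`, AM–GM
`e^{a+x+y/2} ≤ (e^a/2)(e^{2x} + e^y)`, `s = min(s₁, σ·lam/(2R))`, `N₀ = max(N₁, N₂)` with `ℓ_N < ρ` for `N ≥ N₂`.
-/

noncomputable section

open MeasureTheory Set Filter Topology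
open scoped ENNReal Classical

namespace Summit.AtomisticToContinuum.HydrodynamicLimit.Theorems.ShotNoisePressure

open Literature.Analysis.FluidPDE
open Literature.MathematicalPhysics.KineticTheory (T3 V3 hsDiameter localGibbsLaw gaussMeasure hsDiameter_pos
  hsDiameter_le isProbabilityMeasure_localGibbsLaw lintegral_exp_windowAvg_sum_localGibbsLaw_const_le)

/-! ## Hypothesis-free forms of the kinematic and static inputs -/

/-- **Pathwise count** (hypothesis-free): `snp_kinematics_of_tubeCount` fed with `snp_tubeCount` and
`snp_packing`. [folklore] -/
theorem snp_kinematics {N : ℕ} {ε : ℝ} (hε : 0 < ε)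
    (Φ : HardSphereFlow (Torus.geometry (Fin 3)) ε N) {z : Config N (Fin 3) T3} (hz : z ∈ Φ.good)
    {L r : ℝ} (hL : 0 ≤ L) (hr : 0 < r) (hrε : r ≤ ε) {u : ℝ} (hu : u ∈ Icc 0 L) :
    ((Finset.univ.filter fun i : Fin N =>
        (Φ.flow u z i).2 ≠ (z i).2 ∨ r < ∫ t in (0 : ℝ)..L, ‖(Φ.flow t z i).2‖).card : ℝ) ≤
      ((Finset.univ.filter fun i : Fin N =>
          ∃ j : Fin N, j ≠ i ∧ Torus.euclidDist (z i).1 (z j).1 ≤ ε + 2 * r).card : ℝ) +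
        ∑ j : Fin N, (if r < ∫ t in (0 : ℝ)..L, ‖(Φ.flow t z j).2‖ then
          2 + 1331 * ((∫ t in (0 : ℝ)..L, ‖(Φ.flow t z j).2‖) / ε + 1) else 0) :=
  snp_kinematics_of_tubeCount (fun hε' Φ' _ hz' _ _ hL' hr' hrε' j =>
    snp_tubeCount (fun hε'' hρ x₀ x I hs hi => snp_packing hε'' hρ x₀ x I hs hi) hε' Φ' hz' hL' hr' hrε' j)
    hε Φ hz hL hr hrε hu

/-- **Static close-pair pressure** (hypothesis-free): `snp_static_of_pairsBound` fed with `snp_pairsBound`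
and `snp_packing`. [folklore] -/
theorem snp_static (a θ : ℝ) (u₀ : V3) (ha : 0 < a) (hθ : 0 < θ) (σ : ℝ) (hσ : 0 < σ) (hσ4 : σ ≤ 1 / 4)
    (c ψ : ℝ) (hc : 0 ≤ c) (hψ : 0 < ψ) :
    ∃ lam₀ : ℝ, 0 < lam₀ ∧ ∀ lam : ℝ, 0 < lam → lam ≤ lam₀ → ∃ N₀ : ℕ, ∀ N : ℕ, N₀ ≤ N →
      ∀ Φ : HardSphereFlow (Torus.geometry (Fin 3)) (hsDiameter σ N) (N + 1),
      ∫⁻ z, ENNReal.ofReal (Real.exp (c * ((Finset.univ.filter fun i : Fin (N + 1) =>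
          ∃ j : Fin (N + 1), j ≠ i ∧
            Torus.euclidDist (z i).1 (z j).1 ≤ hsDiameter σ N * (1 + lam)).card : ℝ)))
        ∂(localGibbsLaw σ (fun _ => a) (fun _ => u₀) (fun _ => θ) N Φ)
      ≤ ENNReal.ofReal (Real.exp (ψ * (N + 1))) :=
  snp_static_of_pairsBound snp_pairsBound (fun hε hρ x₀ x I hs hi => snp_packing hε hρ x₀ x I hs hi)
    a θ u₀ ha hθ σ hσ hσ4 c ψ hc hψ

/-! ## The pathwise estimate for one good orbit -/

/-- **Pathwise estimate.** For a good orbit of the `N+1` spheres of diameter `ε = hsDiameter σ N`, a horizon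
`L > 0`, a speed threshold `R > 0` with `RL ≤ ε`, `ε + 2RL ≤ ε(1+lam)` and `RL < ρ`, a one-body `f` with `|f| ≤ K₁`
and continuity budget `K₁η` at scale `ρ`, and every `u ∈ [0, L]`:
`A(Σf(zᵢ) − Σf((Φ_u z)ᵢ)) ≤ A(N+1)K₁η + 2AK₁·S(z) + ½·L⁻¹∫₀ᴸ Σᵢ qf((Φ_t z)ᵢ) dt`,
`S` the static close-pair count at width `ε(1+lam)`, `qf(x,v) = (4AK₁·2664/R)·max 0 (2‖v‖ − R)`
(`sum_sub_sum_flow_le` + `snp_kinematics` + `wander_le_windowAvg`). [folklore] -/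
theorem pathwise_estimate {σ : ℝ} (hσ : 0 < σ) {N : ℕ}
    (Φ : HardSphereFlow (Torus.geometry (Fin 3)) (hsDiameter σ N) (N + 1))
    {z : Config (N + 1) (Fin 3) T3} (hz : z ∈ Φ.good) {L R A K₁ η ρ lam : ℝ} (hL : 0 < L) (hR : 0 < R)
    (hA : 0 < A) (hK₁ : 0 < K₁) (hη : 0 ≤ η) (hrε : R * L ≤ hsDiameter σ N)
    (hr2 : hsDiameter σ N + 2 * (R * L) ≤ hsDiameter σ N * (1 + lam)) (hrρ : R * L < ρ)
    (f : T3 × V3 → ℝ) (hfK : ∀ q, |f q| ≤ K₁)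
    (hfcont : ∀ (x y : T3) (v : V3), dist x y < ρ → f (x, v) - f (y, v) ≤ K₁ * η)
    {u : ℝ} (hu : u ∈ Icc 0 L) :
    A * (∑ i, f (z i) - ∑ i, f (Φ.flow u z i)) ≤ A * ((N + 1) * (K₁ * η)) +
      2 * A * K₁ * ((Finset.univ.filter fun i : Fin (N + 1) => ∃ j : Fin (N + 1), j ≠ i ∧
        Torus.euclidDist (z i).1 (z j).1 ≤ hsDiameter σ N * (1 + lam)).card : ℝ) +
      2⁻¹ * (L⁻¹ * ∫ t in (0 : ℝ)..L, ∑ i, 4 * A * K₁ * 2664 / R * max 0 (2 * ‖(Φ.flow t z i).2‖ - R)) := by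
  have hε : 0 < hsDiameter σ N := hsDiameter_pos hσ N
  have hr : 0 < R * L := mul_pos hR hL
  have h1 := sum_sub_sum_flow_le Φ hz (L := L) hrρ hK₁.le hη f hfK hfcont hu
  have h2 := snp_kinematics hε Φ hz hL.le hr hrε hu
  have h3 : ((Finset.univ.filter fun i : Fin (N + 1) => ∃ j : Fin (N + 1), j ≠ i ∧
        Torus.euclidDist (z i).1 (z j).1 ≤ hsDiameter σ N + 2 * (R * L)).card : ℝ) ≤
      ((Finset.univ.filter fun i : Fin (N + 1) => ∃ j : Fin (N + 1), j ≠ i ∧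
        Torus.euclidDist (z i).1 (z j).1 ≤ hsDiameter σ N * (1 + lam)).card : ℝ) := by
    refine Nat.cast_le.2 (Finset.card_le_card fun i hi => ?_)
    simp only [Finset.mem_filter, Finset.mem_univ, true_and] at hi ⊢
    obtain ⟨j, hj, hd⟩ := hi
    exact ⟨j, hj, hd.trans hr2⟩
  have h4 : ∀ j : Fin (N + 1), 4 * A * K₁ * (if R * L < ∫ t in (0 : ℝ)..L, ‖(Φ.flow t z j).2‖
      then 2 + 1331 * ((∫ t in (0 : ℝ)..L, ‖(Φ.flow t z j).2‖) / hsDiameter σ N + 1) else 0) ≤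
      L⁻¹ * ∫ t in (0 : ℝ)..L, 4 * A * K₁ * 2664 / R * max 0 (2 * ‖(Φ.flow t z j).2‖ - R) := fun j =>
    wander_le_windowAvg Φ hz hL hR hA hK₁ hrε j
  have h5 : 4 * A * K₁ * ∑ j : Fin (N + 1), (if R * L < ∫ t in (0 : ℝ)..L, ‖(Φ.flow t z j).2‖
      then 2 + 1331 * ((∫ t in (0 : ℝ)..L, ‖(Φ.flow t z j).2‖) / hsDiameter σ N + 1) else 0) ≤
      L⁻¹ * ∫ t in (0 : ℝ)..L, ∑ i, 4 * A * K₁ * 2664 / R * max 0 (2 * ‖(Φ.flow t z i).2‖ - R) := by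
    rw [Finset.mul_sum]
    refine (Finset.sum_le_sum fun j _ => h4 j).trans (le_of_eq ?_)
    rw [← Finset.mul_sum, intervalIntegral.integral_finsetSum]
    intro i _
    exact Φ.intervalIntegrable_comp_flow_of_continuous hz
      (show Continuous fun w : Config (N + 1) (Fin 3) T3 =>
        4 * A * K₁ * 2664 / R * max 0 (2 * ‖(w i).2‖ - R) by fun_prop) 0 L
  have hAK : 0 ≤ 2 * A * K₁ := by positivity
  have e1 := mul_le_mul_of_nonneg_left h1 hA.le
  have e2 := mul_le_mul_of_nonneg_left h2 hAK
  have e3 := mul_le_mul_of_nonneg_left h3 hAK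
  have hcast : ((N + 1 : ℕ) : ℝ) = (N : ℝ) + 1 := by push_cast; ring
  rw [hcast] at e1
  linarith [e1, e2, e3, h5]

/-- **Exponential form of the pathwise estimate** (average over `u ∈ [0, L]`, exponentiate, `2XY ≤ X² + Y²`):
with `A(N+1)K₁η = (ψ/2)(N+1)`, the integrand of the shot-noise pressure at a good `z` is at most
`(e^{(ψ/2)(N+1)}/2)·(e^{4AK₁S(z)} + e^{L⁻¹∫₀ᴸ Σ qf})`. [folklore] -/
theorem pointwise_exp_estimate {σ : ℝ} (hσ : 0 < σ) {N : ℕ}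
    (Φ : HardSphereFlow (Torus.geometry (Fin 3)) (hsDiameter σ N) (N + 1))
    {z : Config (N + 1) (Fin 3) T3} (hz : z ∈ Φ.good) {L R A K₁ η ρ lam ψ : ℝ} (hL : 0 < L) (hR : 0 < R)
    (hA : 0 < A) (hK₁ : 0 < K₁) (hη : 0 ≤ η) (hrε : R * L ≤ hsDiameter σ N)
    (hr2 : hsDiameter σ N + 2 * (R * L) ≤ hsDiameter σ N * (1 + lam)) (hrρ : R * L < ρ)
    (hψη : A * ((N + 1) * (K₁ * η)) = ψ / 2 * (N + 1))
    (f : T3 × V3 → ℝ) (hfc : Continuous f) (hfK : ∀ q, |f q| ≤ K₁)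
    (hfcont : ∀ (x y : T3) (v : V3), dist x y < ρ → f (x, v) - f (y, v) ≤ K₁ * η) :
    ENNReal.ofReal (Real.exp (A * ((∑ i, f (z i)) - L⁻¹ * ∫ u in (0 : ℝ)..L, ∑ i, f (Φ.flow u z i)))) ≤
      ENNReal.ofReal (Real.exp (ψ / 2 * (N + 1)) / 2) *
        (ENNReal.ofReal (Real.exp (4 * A * K₁ * ((Finset.univ.filter fun i : Fin (N + 1) =>
            ∃ j : Fin (N + 1), j ≠ i ∧ Torus.euclidDist (z i).1 (z j).1 ≤ hsDiameter σ N * (1 + lam)).card : ℝ))) +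
          ENNReal.ofReal (Real.exp (L⁻¹ * ∫ t in (0 : ℝ)..L,
            ∑ i, 4 * A * K₁ * 2664 / R * max 0 (2 * ‖(Φ.flow t z i).2‖ - R)))) := by
  set Sc : ℝ := ((Finset.univ.filter fun i : Fin (N + 1) =>
    ∃ j : Fin (N + 1), j ≠ i ∧ Torus.euclidDist (z i).1 (z j).1 ≤ hsDiameter σ N * (1 + lam)).card : ℝ)
    with hSc
  set Wq : ℝ := L⁻¹ * ∫ t in (0 : ℝ)..L, ∑ i, 4 * A * K₁ * 2664 / R * max 0 (2 * ‖(Φ.flow t z i).2‖ - R)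
    with hWq
  have hFc : Continuous fun w : Config (N + 1) (Fin 3) T3 => ∑ i, f (w i) := by fun_prop
  have hFint : IntervalIntegrable (fun u => ∑ i, f (Φ.flow u z i)) volume 0 L :=
    Φ.intervalIntegrable_comp_flow_of_continuous hz hFc 0 L
  have havg : A * ((∑ i, f (z i)) - L⁻¹ * ∫ u in (0 : ℝ)..L, ∑ i, f (Φ.flow u z i)) ≤
      ψ / 2 * (N + 1) + 2 * A * K₁ * Sc + 2⁻¹ * Wq := by
    refine mul_sub_avg_le hL hFint fun u hu => ?_
    have := pathwise_estimate hσ Φ hz hL hR hA hK₁ hη hrε hr2 hrρ f hfK hfcont hu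
    rw [hψη] at this
    exact this
  have hexp := (Real.exp_le_exp.2 havg).trans (exp_amgm (ψ / 2 * (N + 1)) (2 * A * K₁ * Sc) Wq)
  calc ENNReal.ofReal (Real.exp (A * ((∑ i, f (z i)) - L⁻¹ * ∫ u in (0 : ℝ)..L, ∑ i, f (Φ.flow u z i))))
      ≤ ENNReal.ofReal (Real.exp (ψ / 2 * (N + 1)) / 2 * (Real.exp (2 * (2 * A * K₁ * Sc)) + Real.exp Wq)) :=
        ENNReal.ofReal_le_ofReal hexp
    _ = ENNReal.ofReal (Real.exp (ψ / 2 * (N + 1)) / 2) *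
        (ENNReal.ofReal (Real.exp (4 * A * K₁ * Sc)) + ENNReal.ofReal (Real.exp Wq)) := by
        rw [ENNReal.ofReal_mul (by positivity), ENNReal.ofReal_add (by positivity) (by positivity),
          show 2 * (2 * A * K₁ * Sc) = 4 * A * K₁ * Sc by ring]

/-! ## Assembly -/

/-- **Within-lag shot-noise pressure** — hypothesis `h₂` of
`TransferSkeleton.correctorPressureDecay_of_inputs`, verbatim. [folklore] -/
theorem shotNoisePressure :
    ∀ (a θ : ℝ) (u₀ : V3), 0 < a → 0 < θ → ∃ σ₀ : ℝ, 0 < σ₀ ∧ ∀ σ : ℝ, 0 < σ → σ < σ₀ →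
      ∀ (φ : T3 → ℝ) (g : V3 → ℝ) (K A ψ s₁ : ℝ), Continuous φ → Continuous g → (∀ x, |φ x| ≤ 1) →
      (∀ v, |g v| ≤ K) → 0 < A → 0 < ψ → 0 < s₁ →
      ∃ s : ℝ, 0 < s ∧ s ≤ s₁ ∧ ∃ N₀ : ℕ, ∀ N : ℕ, N₀ ≤ N →
      ∀ Φ : HardSphereFlow (Torus.geometry (Fin 3)) (hsDiameter σ N) (N + 1),
      ∫⁻ z, ENNReal.ofReal (Real.exp (A * ((∑ i, φ (z i).1 * g ((Real.sqrt θ)⁻¹ • ((z i).2 - u₀))) -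
          (s * ((N + 1 : ℕ) : ℝ) ^ (-(1 / 3 : ℝ)))⁻¹ *
            ∫ u in (0 : ℝ)..(s * ((N + 1 : ℕ) : ℝ) ^ (-(1 / 3 : ℝ))),
              ∑ i, φ (Φ.flow u z i).1 * g ((Real.sqrt θ)⁻¹ • ((Φ.flow u z i).2 - u₀)))))
        ∂(localGibbsLaw σ (fun _ => a) (fun _ => u₀) (fun _ => θ) N Φ)
      ≤ ENNReal.ofReal (Real.exp (ψ * (N + 1))) := by
  intro a θ u₀ ha hθ
  refine ⟨1 / 4, by norm_num, fun σ hσ hσ4 => ?_⟩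
  intro φ g K A ψ s₁ hφ hg hφ1 hgK hA hψ hs₁
  -- amplitude floor `K₁ ≥ 1`
  set K₁ : ℝ := max K 1 with hK₁def
  have hK₁ : 1 ≤ K₁ := le_max_right _ _
  have hK₁pos : 0 < K₁ := lt_of_lt_of_le one_pos hK₁
  have hgK₁ : ∀ v, |g v| ≤ K₁ := fun v => (hgK v).trans (le_max_left _ _)
  -- continuity budget `η` and the uniform-continuity radius `ρ` of `φ`
  set η : ℝ := ψ / (2 * A * K₁) with hηdef
  have hη : 0 < η := by positivity
  obtain ⟨ρ, hρ, hφuc⟩ : ∃ ρ > 0, ∀ x y : T3, dist x y < ρ → dist (φ x) (φ y) < η :=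
    Metric.uniformContinuous_iff.1 (CompactSpace.uniformContinuous_of_continuous hφ) η hη
  -- the speed threshold `R` (one-site bound at amplitude `4AK₁·2664`, tolerance `ψ/2`)
  obtain ⟨R, hR1, hRone⟩ := snp_oneSite θ hθ u₀ (4 * A * K₁ * 2664) (ψ / 2) (by positivity) (by positivity)
  have hRpos : 0 < R := lt_of_lt_of_le one_pos hR1
  -- the static tolerance `lam` (amplitude `4AK₁`, tolerance `ψ/2`)
  obtain ⟨lam₀, hlam₀, hstat⟩ := snp_static a θ u₀ ha hθ σ hσ hσ4.le (4 * A * K₁) (ψ / 2)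
    (by positivity) (by positivity)
  set lam : ℝ := min lam₀ 1 with hlamdef
  have hlam : 0 < lam := lt_min hlam₀ one_pos
  have hlam1 : lam ≤ 1 := min_le_right _ _
  obtain ⟨N₁, hN₁⟩ := hstat lam hlam (min_le_left _ _)
  -- the lag `s`
  set s : ℝ := min s₁ (σ * lam / (2 * R)) with hsdef
  have hs : 0 < s := lt_min hs₁ (by positivity)
  have hsR : R * s ≤ σ * lam / 2 := by
    have : s ≤ σ * lam / (2 * R) := min_le_right _ _
    calc R * s ≤ R * (σ * lam / (2 * R)) := by gcongr
      _ = σ * lam / 2 := by field_simp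
  -- `N₀`: the static threshold and `ℓ_N < ρ`
  obtain ⟨N₂, hN₂⟩ := exists_nat_gt (ρ⁻¹ ^ (3 : ℕ))
  refine ⟨s, hs, min_le_left _ _, max N₁ N₂, fun N hN Φ => ?_⟩
  have hNN₁ : N₁ ≤ N := (le_max_left _ _).trans hN
  have hNN₂ : N₂ ≤ N := (le_max_right _ _).trans hN
  have hℓρ : ((N + 1 : ℕ) : ℝ) ^ (-(1 / 3 : ℝ)) < ρ :=
    ell_lt_of_lt hρ (hN₂.trans_le (by exact_mod_cast Nat.le_succ_of_le hNN₂))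
  -- scales
  set ℓ : ℝ := ((N + 1 : ℕ) : ℝ) ^ (-(1 / 3 : ℝ)) with hℓdef
  have hℓ : 0 < ℓ := ell_pos N
  have hεdef : hsDiameter σ N = σ * ℓ := rfl
  have hL : 0 < s * ℓ := mul_pos hs hℓ
  have hrε : R * (s * ℓ) ≤ hsDiameter σ N := by
    rw [hεdef, ← mul_assoc]
    refine mul_le_mul_of_nonneg_right ?_ hℓ.le
    nlinarith [hsR, hlam1, hσ.le, hlam.le]
  have hr2 : hsDiameter σ N + 2 * (R * (s * ℓ)) ≤ hsDiameter σ N * (1 + lam) := by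
    rw [hεdef]; nlinarith [hsR, hℓ.le]
  have hrρ : R * (s * ℓ) < ρ := by
    have h1 : R * (s * ℓ) ≤ 1 * ℓ := by
      rw [← mul_assoc]
      refine mul_le_mul_of_nonneg_right ?_ hℓ.le
      nlinarith [hsR, hlam1, hσ.le, hlam.le, hσ4.le]
    linarith [hℓρ]
  -- the law
  set μ := localGibbsLaw σ (fun _ => a) (fun _ => u₀) (fun _ => θ) N Φ with hμ
  have hstatμ : ∀ t, MeasurePreserving (Φ.flow t) μ μ := fun t =>
    measurePreserving_flow_localGibbsLaw_const σ a θ u₀ N Φ t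
  have hgood : μ Φ.goodᶜ = 0 := BoltzmannGreenKuboOrthMomentum.localGibbsLaw_compl_good a θ u₀ Φ
  have hae : ∀ᵐ z ∂μ, z ∈ Φ.good := mem_ae_iff.2 hgood
  -- the one-body observable
  set f : T3 × V3 → ℝ := fun q => φ q.1 * g ((Real.sqrt θ)⁻¹ • (q.2 - u₀)) with hfdef
  have hfc : Continuous f := by
    simp only [hfdef]
    fun_prop
  have hfK : ∀ q, |f q| ≤ K₁ := fun q => by
    simp only [hfdef]
    rw [abs_mul]
    calc |φ q.1| * |g ((Real.sqrt θ)⁻¹ • (q.2 - u₀))| ≤ 1 * K₁ :=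
          mul_le_mul (hφ1 _) (hgK₁ _) (abs_nonneg _) zero_le_one
      _ = K₁ := one_mul _
  have hfcont : ∀ (x y : T3) (v : V3), dist x y < ρ → f (x, v) - f (y, v) ≤ K₁ * η := by
    intro x y v hxy
    simp only [hfdef]
    have h1 : |φ x - φ y| < η := by
      have := hφuc x y hxy
      rwa [Real.dist_eq] at this
    have h2 := hgK₁ ((Real.sqrt θ)⁻¹ • (v - u₀))
    calc φ x * g ((Real.sqrt θ)⁻¹ • (v - u₀)) - φ y * g ((Real.sqrt θ)⁻¹ • (v - u₀))
        = (φ x - φ y) * g ((Real.sqrt θ)⁻¹ • (v - u₀)) := by ring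
      _ ≤ |(φ x - φ y) * g ((Real.sqrt θ)⁻¹ • (v - u₀))| := le_abs_self _
      _ = |φ x - φ y| * |g ((Real.sqrt θ)⁻¹ • (v - u₀))| := abs_mul _ _
      _ ≤ η * K₁ := mul_le_mul h1.le h2 (abs_nonneg _) hη.le
      _ = K₁ * η := mul_comm _ _
  have hψη : A * ((N + 1) * (K₁ * η)) = ψ / 2 * (N + 1) := by
    simp only [hηdef]
    field_simp
  -- the one-site functional is continuous and has one-site moment `≤ e^{ψ/2}`
  have hqfc : Continuous fun q : T3 × V3 => 4 * A * K₁ * 2664 / R * max 0 (2 * ‖q.2‖ - R) := by fun_prop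
  have hQc : Continuous fun w : Config (N + 1) (Fin 3) T3 =>
      ∑ i, 4 * A * K₁ * 2664 / R * max 0 (2 * ‖(w i).2‖ - R) := by fun_prop
  -- (1)-(2) pointwise
  have key2 : ∀ z ∈ Φ.good,
      ENNReal.ofReal (Real.exp (A * ((∑ i, f (z i)) -
        (s * ℓ)⁻¹ * ∫ u in (0 : ℝ)..(s * ℓ), ∑ i, f (Φ.flow u z i)))) ≤
      ENNReal.ofReal (Real.exp (ψ / 2 * (N + 1)) / 2) *
        (ENNReal.ofReal (Real.exp (4 * A * K₁ * ((Finset.univ.filter fun i : Fin (N + 1) =>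
            ∃ j : Fin (N + 1), j ≠ i ∧ Torus.euclidDist (z i).1 (z j).1 ≤ hsDiameter σ N * (1 + lam)).card : ℝ))) +
          ENNReal.ofReal (Real.exp ((s * ℓ)⁻¹ * ∫ t in (0 : ℝ)..(s * ℓ),
            ∑ i, 4 * A * K₁ * 2664 / R * max 0 (2 * ‖(Φ.flow t z i).2‖ - R)))) := fun z hz =>
    pointwise_exp_estimate hσ Φ hz hL hRpos hA hK₁pos hη.le hrε hr2 hrρ hψη f hfc hfK hfcont
  -- (3) integrate
  have hSint := hN₁ N hNN₁ Φ
  have hWint : ∫⁻ z, ENNReal.ofReal (Real.exp ((s * ℓ)⁻¹ * ∫ t in (0 : ℝ)..(s * ℓ),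
      ∑ i, 4 * A * K₁ * 2664 / R * max 0 (2 * ‖(Φ.flow t z i).2‖ - R))) ∂μ ≤
      ENNReal.ofReal (Real.exp (ψ / 2 * (N + 1))) := by
    have h := lintegral_exp_windowAvg_sum_localGibbsLaw_const_le ha hθ u₀ (by linarith : σ ≤ 1 / 2) N Φ
      hstatμ hqfc (C := ENNReal.ofReal (Real.exp (ψ / 2))) (fun _ => hRone R le_rfl) hL
    refine h.trans (le_of_eq ?_)
    rw [← ENNReal.ofReal_pow (Real.exp_pos _).le, ← Real.exp_nat_mul]
    congr 2
    push_cast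
    ring
  have hWmeas : AEMeasurable (fun z => ENNReal.ofReal (Real.exp ((s * ℓ)⁻¹ * ∫ t in (0 : ℝ)..(s * ℓ),
      ∑ i, 4 * A * K₁ * 2664 / R * max 0 (2 * ‖(Φ.flow t z i).2‖ - R)))) μ := by
    have h1 := Φ.aemeasurable_intervalIntegral_comp_flow_torus hQc.measurable 0 (s * ℓ) hgood
    exact ENNReal.measurable_ofReal.comp_aemeasurable
      (Real.measurable_exp.comp_aemeasurable (h1.const_mul _))
  refine (lintegral_le_of_ae_le_mul_add ENNReal.ofReal_ne_top (hae.mono key2) hSint hWint hWmeas).trans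
    (le_of_eq ?_)
  rw [← ENNReal.ofReal_add (by positivity) (by positivity), ← ENNReal.ofReal_mul (by positivity),
    ← two_mul, show ψ * (N + 1) = ψ / 2 * (N + 1) + ψ / 2 * (N + 1) by ring, Real.exp_add]
  congr 1
  ring

/-- Read-back: `shotNoisePressure` is literally the hypothesis `h₂` of the layer-2 transfer — with `h₁` (influence
locality, eventual form) and `h₃` (forecast-window pressure) the crux `CorrectorPressureDecay` follows. [folklore] -/
example := fun h₁ h₃ =>
  (TransferSkeleton.correctorPressureDecay_of_inputs h₁ shotNoisePressure h₃ :
    Summit.AtomisticToContinuum.HydrodynamicLimit.Theses.AntiMazurCoboundaries.CorrectorPressureDecay)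

/-- **Layer-2 residual after this file.** `h₁` is BY DEFINITION the target
`TrueAnchoredInfection.InfluenceLocalityEventually` of the line `true-anchored-infection` of crux `InfluenceLocality`
(stmt-AtomisticToContinuum-13916); with `h₂ := shotNoisePressure` the crux `CorrectorPressureDecay` follows from that target
and the FORECAST-WINDOW PRESSURE `h₃` alone (= the N-free core `CellForecastPressureDecay`, stmt-13915, composed with the static
torus transfer; typed here verbatim as in `TransferSkeleton.correctorPressureDecay_of_inputs`, not yet an item). [folklore] -/
theorem correctorPressureDecay_of_locality_of_forecastWindow
    (h₁ : TrueAnchoredInfection.InfluenceLocalityEventually)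
    (h₃ : ∀ (a θ : ℝ) (u₀ : V3), 0 < a → 0 < θ → ∃ σ₀ : ℝ, 0 < σ₀ ∧ ∀ σ : ℝ, 0 < σ → σ < σ₀ →
      ∃ κ : ℝ, 0 < κ ∧ ∀ (φ : T3 → ℝ) (g : V3 → ℝ), Continuous φ → Continuous g → (∀ x, |φ x| ≤ 1) →
      (∀ v, |g v| ≤ κ) →
      (∀ (c₀ c₂ : ℝ) (b : V3),
        ∫ v, g v * (c₀ + inner ℝ b v + c₂ * ‖v‖ ^ 2) ∂(ProbabilityTheory.stdGaussian V3) = 0) →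
      ∀ δ : ℝ, 0 < δ → ∃ T : ℝ, 0 < T ∧ ∃ R₀ : ℝ, 0 < R₀ ∧ ∀ R : ℝ, R₀ ≤ R → ∃ N₀ : ℕ, ∀ N : ℕ, N₀ ≤ N →
      ∀ (Φ : HardSphereFlow (Torus.geometry (Fin 3)) (hsDiameter σ N) (N + 1))
        (Ψ : (k : ℕ) → HardSphereFlow (Torus.geometry (Fin 3)) (hsDiameter σ N) k),
      ∫⁻ z, ENNReal.ofReal (Real.exp (∑ i, (T * ((N + 1 : ℕ) : ℝ) ^ (-(1 / 3 : ℝ)))⁻¹ *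
          ∫ t in (0 : ℝ)..(T * ((N + 1 : ℕ) : ℝ) ^ (-(1 / 3 : ℝ))),
            φ (localClusterState Ψ (R * ((N + 1 : ℕ) : ℝ) ^ (-(1 / 3 : ℝ))) t z i).1 *
              g ((Real.sqrt θ)⁻¹ • ((localClusterState Ψ (R * ((N + 1 : ℕ) : ℝ) ^ (-(1 / 3 : ℝ))) t z i).2 - u₀))))
        ∂(localGibbsLaw σ (fun _ => a) (fun _ => u₀) (fun _ => θ) N Φ)
      ≤ ENNReal.ofReal (Real.exp (δ * (N + 1)))) :
    Summit.AtomisticToContinuum.HydrodynamicLimit.Theses.AntiMazurCoboundaries.CorrectorPressureDecay :=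
  TransferSkeleton.correctorPressureDecay_of_inputs h₁ shotNoisePressure h₃

end Summit.AtomisticToContinuum.HydrodynamicLimit.Theorems.ShotNoisePressure

end
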